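import Summits.BirchSwinnertonDyer.BirchSwinnertonDyer.Theorems.PrintX11aUpperNonSurjFiveExcShallowSector
import Literature.NumberTheory.EllipticCurves.ModularCurveProofs
import Literature.NumberTheory.EllipticCurves.SemistablePeuRamifieRamifiedPrime
import HarnessLib

/-!
# Crux U5 `PrintX11a.UpperNonSurjFive` (item stmt-BirchSwinnertonDyer-20614), line «gl1cartan5»:
# NO PAIR OF U5 IS SEMISTABLE — every X11a pair with non-surjective `ρ̄_{E,p}`, `p ≥ 5`, has an ADDITIVE prime
# (the Frey–Serre–Ribet mechanism, modulo two named print facts of the line: modularity and level lowering at `p ≥ 5`)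

Cell `bsd-print-x11a`, seat `cruxlead-stmt-BirchSwinnertonDyer-20614` (LEAD g9); `--supports stmt-BirchSwinnertonDyer-20614`, closes
nothing. HONEST FRAMING: BSD is not proved by any of this; nothing here bounds a non-trivial `Ш`; no statement of the summit is proved;
the main theorem is CONDITIONAL on two named published facts taken BY NAME as hypotheses (`hnf` modularity, `hLL` =
`ribet1990_levelLowering_gamma0_newform_general_of_five_le`, Darmon–Diamond–Taylor Thm. 3.15 at `p ≥ 5`, both already among the eleven
print inputs `PrintFacts` of the line of record).

WHAT. On class X11a (`r_an = 0`, `p ∥ N`, `E[p]` irreducible, no (ram) prime: every multiplicative `ℓ ≠ p` has `p ∣ ord_ℓ Δ_min`) at a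
NON-surjective `p ≥ 5` the prime `p` is finite too (`p ∣ ord_p Δ_min`, `ClassX11a.dvd_padicValInt_self_of_not_surj`: otherwise inertia at
`p` contains a transvection). So `ρ̄ = E[p]` is unramified at EVERY multiplicative prime `≠ p` and finite at `p`: its optimal level is the
ADDITIVE part `M₀ = N/(D·p)` of the conductor (`D` = product of the multiplicative primes `≠ p`). If `E` were semistable, `M₀ = 1` and the
level-lowering fact would produce a NEWFORM in `S₂(Γ₀(1)) = S₂(SL₂(ℤ)) = 0` (Mathlib: `CuspForm.rank_eq_zero_of_weight_lt_twelve`) — the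
contradiction of Serre (1987, §4) ∕ Ribet (1990) for the Frey curve, here for any would-be semistable U5 pair. Hence:
★ `not_semistable_of_classX11a_not_surj` — «X11a ∧ ¬Surj ∧ 5 ≤ p ⟹ ¬ Semistable E», i.e. `E` has an additive prime `q` (`q² ∣ N`,
`q ≠ p`), the conductor is not squarefree, and the optimal level `M₀` of `ρ̄` satisfies `q² ∣ M₀` for each of its prime factors, so
`4 ≤ M₀` (§4).  USE: (i) every road of the crux that lowers the level to `M₀` (the landed EXC road, the published lines «oldprod5»,
«llzero5») works at a level `M₀ ≥ 4` carrying a square — Vatsal's ∕ Greenberg–Vatsal's level hypotheses are met at the optimal level, and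
the Ribet–Takahashi ∕ Takahashi degree formula is NEVER available in its printed square-free-level form on U5 (critic idea-crit-10 V#141 P1
on the line «grossdef5»: now a kernel fact rather than a census observation); (ii) census sanity: all 56 known pairs at `p = 5`,
`N < 5·10⁵`, and the 5 known pairs at `p = 7` have a square factor in `N` (e.g. `118080 = 2⁶·3²·5·41`, `346560 = 2⁶·3·5·19²`).

References: Darmon–Diamond–Taylor 1995 Thm. 3.15; Ribet 1990 Thm. 1.1; Serre 1987 §4.1–4.2 (the level-`2`/level-`1` contradiction);
Diamond–Shurman Thm. 3.5.2 (`dim S₂(SL₂(ℤ)) = 0`); Silverman ATAEC IV.10.2 (multiplicative ⟺ `ℓ ∥ N`).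
-/

noncomputable section

open scoped MatrixGroups ModularForm Classical

open CongruenceSubgroup WeierstrassCurve
  Literature.NumberTheory.EllipticCurves
  Literature.NumberTheory.EllipticCurves.ModularForms
  Literature.NumberTheory.EllipticCurves.Rank1Residual
  Literature.NumberTheory.EllipticCurves.Rank1Residual.Typed
  Summit.BirchSwinnertonDyer.Rank1Residual

set_option linter.dupNamespace false

namespace Summit.BirchSwinnertonDyer.BirchSwinnertonDyer.Theorems.GL1Cartan

/-! ### §1 Level one: `Γ₀(1) = SL₂(ℤ)` (tree: `ModularForms.gamma0_one_eq_top`, `coe_gamma0_one`) carries no weight-two cusp form, hence no newform -/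

section LevelOne

/-- **`S₂(Γ₀(1)) = 0`**: there is no non-zero cusp form of weight `2` and level `1` (Mathlib's level-one dimension formula,
`CuspForm.rank_eq_zero_of_weight_lt_twelve`, transported along the tree's `ModularForms.coe_gamma0_one : Γ₀(1) = 𝒮ℒ`;
cf. the tree's `finrank_cuspForm_two_eq_genusX0_one` and `cuspForm_gamma1_one_eq_zero_of_lt_twelve`, the `Γ₁(1)` twin; the same
statement is proved in the ABC summit tree as `Summit.ABC.ABC.Theorems.FreyDegreeBound.Negative.cuspForm_gamma0_one_eq_zero`, not importable here).
[cite: DiamondShurman2005, Thm. 3.5.2 and Fig. 3.4] -/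
theorem cuspForm_gamma0_one_weight_two_eq_zero (g : CuspForm (CongruenceSubgroup.Gamma0 1) 2) : g = 0 := by
  have key : ∀ Γ : Subgroup (GL (Fin 2) ℝ), Γ = 𝒮ℒ → ∀ g : CuspForm Γ 2, g = 0 := by
    rintro Γ rfl g
    exact rank_zero_iff_forall_zero.mp (CuspForm.rank_eq_zero_of_weight_lt_twelve (by norm_num)) g
  exact key _ coe_gamma0_one g

/-- **No newform of weight `2` and level `1`**: a newform is normalised (`a₁ = 1`), the zero form has `a₁ = 0`.
[cite: DiamondShurman2005, Thm. 3.5.2 and Def. 5.8.1] -/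
theorem not_isNewform0_gamma0_one_weight_two (g : CuspForm (CongruenceSubgroup.Gamma0 1) 2) : ¬ IsNewform0 g := by
  rintro ⟨-, -, hnorm⟩
  have hg : g = 0 := cuspForm_gamma0_one_weight_two_eq_zero g
  have h0 : (UpperHalfPlane.qExpansion 1 ⇑g).coeff 1 = 0 := by
    have h := qExpansion_coeff_smul 1 2 (0 : ℂ) g 1
    rw [zero_smul, zero_mul] at h
    rw [hg]
    exact h
  rw [IsNormalized] at hnorm
  rw [h0] at hnorm
  exact zero_ne_one hnorm

end LevelOne

/-! ### §2 On a semistable curve the optimal level of the multiplicative decomposition is `1` -/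

section Decomposition

variable {W : WeierstrassCurve ℚ} [W.IsElliptic] {p : ℕ} [Fact p.Prime]

/-- In the decomposition `N = M₀·D·p` of `Exc.exists_multDecomposition` (`D` = the multiplicative primes `≠ p`, `p ∤ M₀D`, `D ⊥ M₀`),
every prime factor `q` of `M₀` is a bad prime which is NOT multiplicative — an additive prime (`q² ∣ N`). [cite: SilvermanATAEC1994, Thm. IV.10.2 (a)–(c)] -/
theorem addv_of_dvd_optimalLevel {M₀ D : ℕ} (hMD : M₀ * D * p = W.conductorNorm ℤ) (hpMD : ¬ p ∣ M₀ * D)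
    (hDM₀ : Nat.Coprime D M₀)
    (hmultD : ∀ (q : ℕ) (hq : q.Prime), (haveI : Fact q.Prime := ⟨hq⟩; W.HasMultiplicativeReductionAtPrime q) → q ≠ p → q ∣ D)
    {q : ℕ} (hq : q.Prime) (hqM : q ∣ M₀) : haveI : Fact q.Prime := ⟨hq⟩; Addv W q := by
  haveI : Fact q.Prime := ⟨hq⟩
  have hqN : q ∣ W.conductorNorm ℤ := by
    rw [← hMD]; exact (hqM.mul_right D).mul_right p
  have hng : ¬ W.HasGoodReductionAtPrime q := fun hg => not_dvd_conductorNorm_of_hasGoodReductionAtPrime W hg hqN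
  refine ⟨hng, fun hqm => ?_⟩
  have hqp : q ≠ p := by
    rintro rfl; exact hpMD (hqM.mul_right D)
  have hqD : q ∣ D := hmultD q hq hqm hqp
  exact hq.one_lt.ne'
    (Nat.Coprime.eq_one_of_dvd (Nat.Coprime.coprime_dvd_left hqD (Nat.Coprime.coprime_dvd_right hqM hDM₀)) dvd_rfl)

/-- A prime factor `q` of the optimal level `M₀` divides it to the second power: `q` is additive, so `q² ∣ N = M₀·D·p`, and `q ∤ D·p`.
[cite: SilvermanATAEC1994, Thm. IV.10.2 (a)–(c)] -/
theorem sq_dvd_optimalLevel_of_prime_dvd {M₀ D : ℕ} (hMD : M₀ * D * p = W.conductorNorm ℤ) (hpMD : ¬ p ∣ M₀ * D)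
    (hDM₀ : Nat.Coprime D M₀)
    (hmultD : ∀ (q : ℕ) (hq : q.Prime), (haveI : Fact q.Prime := ⟨hq⟩; W.HasMultiplicativeReductionAtPrime q) → q ≠ p → q ∣ D)
    {q : ℕ} (hq : q.Prime) (hqM : q ∣ M₀) : q ^ 2 ∣ M₀ := by
  haveI : Fact q.Prime := ⟨hq⟩
  have hadd := addv_of_dvd_optimalLevel hMD hpMD hDM₀ hmultD hq hqM
  -- `q² ∣ N`: a bad prime with `q² ∤ N` is multiplicative
  have hq2N : q ^ 2 ∣ W.conductorNorm ℤ := by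
    by_contra h
    rcases hasGoodReductionAtPrime_or_hasMultiplicativeReductionAtPrime_of_not_sq_dvd_conductorNorm (V := W) h with hg | hm
    · exact hadd.1 hg
    · exact hadd.2 hm
  have hqp : q ≠ p := by
    rintro rfl; exact hpMD (hqM.mul_right D)
  have hqD : ¬ q ∣ D := fun hqD =>
    hq.one_lt.ne' (Nat.Coprime.eq_one_of_dvd (Nat.Coprime.coprime_dvd_left hqD (Nat.Coprime.coprime_dvd_right hqM hDM₀)) dvd_rfl)
  have hcop : Nat.Coprime (q ^ 2) (D * p) :=
    Nat.Coprime.pow_left 2 (Nat.Coprime.mul_right ((Nat.Prime.coprime_iff_not_dvd hq).mpr hqD)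
      ((Nat.coprime_primes hq Fact.out).mpr hqp))
  rw [← hMD, mul_assoc] at hq2N
  exact hcop.dvd_of_dvd_mul_right hq2N

/-- On a SEMISTABLE curve the optimal level is `1`: `M₀` has no prime factor (each would be an additive prime). [cite: SilvermanATAEC1994, Thm. IV.10.2 (a)–(c)] -/
theorem optimalLevel_eq_one_of_semistable {M₀ D : ℕ} (hMD : M₀ * D * p = W.conductorNorm ℤ) (hpMD : ¬ p ∣ M₀ * D)
    (hDM₀ : Nat.Coprime D M₀)
    (hmultD : ∀ (q : ℕ) (hq : q.Prime), (haveI : Fact q.Prime := ⟨hq⟩; W.HasMultiplicativeReductionAtPrime q) → q ≠ p → q ∣ D)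
    (hss : Semistable W) : M₀ = 1 := by
  by_contra h1
  obtain ⟨q, hq, hqM⟩ := Nat.exists_prime_and_dvd h1
  have hadd := addv_of_dvd_optimalLevel hMD hpMD hDM₀ hmultD hq hqM
  rcases hss q hq with hg | hm
  · exact hadd.1 hg
  · exact hadd.2 hm

end Decomposition

/-! ### §3 ★ No U5 pair is semistable (modulo modularity and level lowering at `p ≥ 5`) -/

section Main

variable {W : WeierstrassCurve ℚ} [W.IsElliptic] [W.IsGloballyMinimal] {p : ℕ} [Fact p.Prime]

/-- ★ **NO PAIR OF U5 IS SEMISTABLE (CONDITIONAL on two named facts: modularity `hnf`, level lowering `hLL`).** At an X11a pair `(W, p)` with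
`ρ̄_{E,p}` NOT surjective and `5 ≤ p`, the curve is NOT semistable: `ρ̄` is irreducible, unramified at every multiplicative prime `ℓ ≠ p`
(`¬ Ram`) and finite at `p` (`ClassX11a.dvd_padicValInt_self_of_not_surj`), so on a semistable curve the level-lowering fact (with the
removed set `R = D·p` = ALL bad primes, optimal level `M₀ = N/R = 1`, §2) yields a newform in `S₂(Γ₀(1)) = 0` (§1) — absurd.  This is the
Frey–Serre–Ribet contradiction; it says every U5 pair has an additive prime.
[cite: DarmonDiamondTaylor1995, Thm. 3.15 (pp. 90–91) and Prop. 2.12] [cite: Ribet1990, Thm. 1.1] [cite: DiamondShurman2005, Thm. 3.5.2] -/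
theorem not_semistable_of_classX11a_not_surj (hnf : exists_isNewformOf)
    (hLL : ribet1990_levelLowering_gamma0_newform_general_of_five_le)
    (hX : ClassX11a W p) (hns : ¬ Surj W p) (hp5 : 5 ≤ p) : ¬ Semistable W := by
  intro hss
  have hp : p.Prime := Fact.out
  haveI : NeZero (W.conductorNorm ℤ) := ⟨(W.conductorNorm_pos_holds).ne'⟩
  obtain ⟨f, hf⟩ := hnf W
  have hmult : W.HasMultiplicativeReductionAtPrime p := hX.2.2.1
  obtain ⟨M₀, D, hM₀0, hMD, hpMD, hDsq, hDM₀, hDprimes, hmultD⟩ := Exc.exists_multDecomposition W p hmult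
  have hM₀1 : M₀ = 1 := optimalLevel_eq_one_of_semistable hMD hpMD hDM₀ hmultD hss
  subst hM₀1
  have hpD : ¬ p ∣ D := fun h => hpMD (h.mul_left 1)
  have hMR : 1 * (D * p) = W.conductorNorm ℤ := by rw [← mul_assoc]; exact hMD
  have hRsq : Squarefree (D * p) :=
    (Nat.squarefree_mul ((Nat.Prime.coprime_iff_not_dvd hp).mpr hpD).symm).mpr ⟨hDsq, hp.prime.squarefree⟩
  have hRcop : Nat.Coprime (D * p) 1 := Nat.coprime_one_right _
  have hp2N : ¬ p ^ 2 ∣ W.conductorNorm ℤ :=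
    Theorems.not_sq_dvd_conductorNorm_of_hasMultiplicativeReductionAtPrime W p hmult
  have hR : ∀ (r : ℕ) (hr : r.Prime), r ∣ D * p →
      (haveI : Fact r.Prime := ⟨hr⟩; W.HasMultiplicativeReductionAtPrime r) ∧ p ∣ padicValInt r W.minimalDiscriminantInt := by
    intro r hr hrDp
    by_cases hrp : r = p
    · subst hrp
      exact ⟨hmult, hX.dvd_padicValInt_self_of_not_surj hns⟩
    · have hrD : r ∣ D := by
        rcases (Nat.Prime.dvd_mul hr).mp hrDp with h | h
        · exact h
        · exact absurd ((Nat.prime_dvd_prime_iff_eq hr hp).mp h) hrp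
      obtain ⟨-, hmr⟩ := hDprimes r hr hrD
      haveI : Fact r.Prime := ⟨hr⟩
      refine ⟨hmr, ?_⟩
      by_contra hnd
      exact hX.2.2.2.2 ⟨r, ⟨hr⟩, hrp, hmr, hnd⟩
  have hK : ∀ (q : ℕ) (hq : q.Prime), (haveI : Fact q.Prime := ⟨hq⟩; W.HasMultiplicativeReductionAtPrime q) → ¬ q ∣ D * p →
      ¬ p ∣ padicValInt q W.minimalDiscriminantInt := by
    intro q hq hqm hqR
    exfalso
    by_cases hqp : q = p
    · subst hqp; exact hqR (dvd_mul_left q D)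
    · exact hqR ((hmultD q hq hqm hqp).mul_right p)
  set ι : PadicAlgCl p ≃+* ℂ := Classical.choice (PadicAlgCl.nonempty_ringEquiv_complex p) with hι
  obtain ⟨g, hg, -, -⟩ := hLL W p hp5 hX.irr hMR hRsq hRcop hp2N rfl hR hK f hf ι
  exact not_isNewform0_gamma0_one_weight_two g hg

/-- ★ **Every U5 pair has an ADDITIVE prime `q ≠ p`** (conditional on `hnf`, `hLL`): the positive form of
`not_semistable_of_classX11a_not_surj` (`p` itself is multiplicative on X11a). [cite: DarmonDiamondTaylor1995, Thm. 3.15] [cite: SilvermanAEC2009, Prop. VII.5.1] -/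
theorem exists_addv_of_classX11a_not_surj (hnf : exists_isNewformOf)
    (hLL : ribet1990_levelLowering_gamma0_newform_general_of_five_le)
    (hX : ClassX11a W p) (hns : ¬ Surj W p) (hp5 : 5 ≤ p) :
    ∃ (q : ℕ) (_ : Fact q.Prime), q ≠ p ∧ Addv W q := by
  have h := not_semistable_of_classX11a_not_surj hnf hLL hX hns hp5
  simp only [Semistable, not_forall, not_or] at h
  obtain ⟨q, hq, hng, hnm⟩ := h
  refine ⟨q, ⟨hq⟩, ?_, hng, hnm⟩
  rintro rfl
  exact hnm hX.2.2.1

/-- ★ **The conductor of a U5 pair is not squarefree** (conditional on `hnf`, `hLL`): an additive prime `q` has `q² ∣ N`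
(a bad prime with `q² ∤ N` is multiplicative, Silverman ATAEC IV.10.2). [cite: DarmonDiamondTaylor1995, Thm. 3.15] [cite: SilvermanATAEC1994, Thm. IV.10.2 (a)–(c)] -/
theorem exists_sq_dvd_conductorNorm_of_classX11a_not_surj (hnf : exists_isNewformOf)
    (hLL : ribet1990_levelLowering_gamma0_newform_general_of_five_le)
    (hX : ClassX11a W p) (hns : ¬ Surj W p) (hp5 : 5 ≤ p) :
    ∃ q : ℕ, q.Prime ∧ q ≠ p ∧ q ^ 2 ∣ W.conductorNorm ℤ := by
  obtain ⟨q, hq, hqp, hng, hnm⟩ := exists_addv_of_classX11a_not_surj hnf hLL hX hns hp5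
  refine ⟨q, hq.out, hqp, ?_⟩
  by_contra h
  rcases hasGoodReductionAtPrime_or_hasMultiplicativeReductionAtPrime_of_not_sq_dvd_conductorNorm (V := W) h with hg | hm
  · exact hng hg
  · exact hnm hm

/-- ★ **`N` is not squarefree on U5** (conditional on `hnf`, `hLL`). [cite: DarmonDiamondTaylor1995, Thm. 3.15] [cite: SilvermanATAEC1994, Thm. IV.10.2 (a)–(c)] -/
theorem not_squarefree_conductorNorm_of_classX11a_not_surj (hnf : exists_isNewformOf)
    (hLL : ribet1990_levelLowering_gamma0_newform_general_of_five_le)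
    (hX : ClassX11a W p) (hns : ¬ Surj W p) (hp5 : 5 ≤ p) : ¬ Squarefree (W.conductorNorm ℤ) := by
  obtain ⟨q, hq, -, hq2⟩ := exists_sq_dvd_conductorNorm_of_classX11a_not_surj hnf hLL hX hns hp5
  intro hsq
  rw [pow_two] at hq2
  exact hq.one_lt.ne' (Nat.isUnit_iff.mp (hsq q hq2))

/-- **The same conclusion from the tree's level-one theorem in Serre-conjecture currency** (conditional on modularity `hmod` and
`diamond1995_refinedSerre`, the level-lowering fact of `SemistablePeuRamifieRamifiedPrime`): for EVERY X11a pair with `ρ̄` not surjective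
(any `p`; on X11a `p ≠ 2`), `E` is not semistable — a semistable curve with irreducible `E[p]`, multiplicative and peu ramifié at `p`, has a
(ram) prime (`ram_of_semistable_of_irr_of_mult_of_dvd`), which X11a forbids.  Consistency check of the two roads; no `5 ≤ p` needed here.
[cite: Ribet1990, Thm. 1.1] [cite: Diamond1995RefinedSerre, Thm. 1.1] [cite: Serre1987, §4.1 (4.1.12)] -/
theorem not_semistable_of_classX11a_not_surj_of_refinedSerre (hmod : exists_isNewformOf) (hD : Literature.NumberTheory.Automorphic.diamond1995_refinedSerre)
    (hX : ClassX11a W p) (hns : ¬ Surj W p) : ¬ Semistable W := fun hss =>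
  hX.2.2.2.2 (ram_of_semistable_of_irr_of_mult_of_dvd hmod hD W p hX.2.1 hX.2.2.1
    (hX.dvd_padicValInt_self_of_not_surj hns) hss hX.irr)

/-- **At `p ≤ 7` no X11a pair at all is semistable, surjective or not** (conditional on `hmod`, `diamond1995_refinedSerre`): by the tree's
`ram_of_semistable_of_irr_of_le_seven` (Serre weight `≤ p + 1 ≤ 8 < 12`, `S_k(SL₂(ℤ)) = 0`), a semistable curve with irreducible `E[p]`,
`p ∈ {3, 5, 7}`, has a (ram) prime.  The item's informal statement places every U5 pair at `p ∈ {5, 7}` (BDMTV Thm. 1.2 with the Tate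
transvection: images `5Ns`/`5S4`/`7Ns`); at those primes X11a lives on non-semistable curves independently of the image.
[cite: Ribet1990, Thm. 1.1] [cite: Diamond1995RefinedSerre, Thm. 1.1]
[cite: Serre1987, §2.4 (ii) and §4.1 (4.1.12)] [cite: DiamondShurman2005, Thm. 3.5.2] -/
theorem not_semistable_of_classX11a_of_le_seven (hmod : exists_isNewformOf) (hD : Literature.NumberTheory.Automorphic.diamond1995_refinedSerre)
    (hX : ClassX11a W p) (hp7 : p ≤ 7) : ¬ Semistable W := fun hss =>
  hX.2.2.2.2 (ram_of_semistable_of_irr_of_le_seven hmod hD W p hX.2.1 hp7 hss hX.irr)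

end Main

/-! ### §4 The optimal level of `ρ̄` on U5: `M₀ ≠ 1`, squareful, `4 ≤ M₀` -/

section OptimalLevel

variable {W : WeierstrassCurve ℚ} [W.IsElliptic] [W.IsGloballyMinimal] {p : ℕ} [Fact p.Prime]

/-- ★ **On U5 the optimal level `M₀ = N/(D·p)` (`D` = the multiplicative primes `≠ p`) is `≠ 1`, and `4 ≤ M₀`** (conditional on `hnf`, `hLL`):
`M₀ = 1` would make `W` semistable (every bad prime is `p` or divides the squarefree `D`); and every prime factor of `M₀` divides it twice
(`sq_dvd_optimalLevel_of_prime_dvd`), so `M₀ ≥ q² ≥ 4`.  This is the level at which the level-lowered newform of the EXC road lives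
(`Exc.exists_multDecomposition` ∕ `ribet1990_levelLowering_gamma0_newform_general_of_five_le`); Vatsal's and Greenberg–Vatsal's congruence
theorems ask `4 ≤ M` resp. `5 ≤ M` of their level. [cite: DarmonDiamondTaylor1995, Thm. 3.15 and Lemma 2.7] [cite: Vatsal1999, §1 (1.1)]
[cite: SilvermanATAEC1994, Thm. IV.10.2 (a)–(c)] -/
theorem four_le_optimalLevel_of_classX11a_not_surj (hnf : exists_isNewformOf)
    (hLL : ribet1990_levelLowering_gamma0_newform_general_of_five_le)
    (hX : ClassX11a W p) (hns : ¬ Surj W p) (hp5 : 5 ≤ p)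
    {M₀ D : ℕ} (hM₀ : M₀ ≠ 0) (hMD : M₀ * D * p = W.conductorNorm ℤ) (hpMD : ¬ p ∣ M₀ * D) (hDM₀ : Nat.Coprime D M₀)
    (hDprimes : ∀ (r : ℕ) (hr : r.Prime), r ∣ D → r ≠ p ∧ (haveI : Fact r.Prime := ⟨hr⟩; W.HasMultiplicativeReductionAtPrime r))
    (hmultD : ∀ (q : ℕ) (hq : q.Prime), (haveI : Fact q.Prime := ⟨hq⟩; W.HasMultiplicativeReductionAtPrime q) → q ≠ p → q ∣ D) :
    M₀ ≠ 1 ∧ 4 ≤ M₀ := by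
  have hp : p.Prime := Fact.out
  -- `M₀ ≠ 1`: otherwise every bad prime is multiplicative
  have hne : M₀ ≠ 1 := by
    intro h1
    subst h1
    apply not_semistable_of_classX11a_not_surj hnf hLL hX hns hp5
    intro ℓ hℓ
    haveI : Fact ℓ.Prime := ⟨hℓ⟩
    by_cases hg : W.HasGoodReductionAtPrime ℓ
    · exact Or.inl hg
    · right
      have hℓN : ℓ ∣ W.conductorNorm ℤ := X9.PrintCert.dvd_conductorNorm_of_not_hasGoodReductionAtPrime W hg
      rw [← hMD, one_mul] at hℓN
      rcases (Nat.Prime.dvd_mul hℓ).mp hℓN with h | h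
      · exact (hDprimes ℓ hℓ h).2
      · have : ℓ = p := (Nat.prime_dvd_prime_iff_eq hℓ hp).mp h
        subst this
        exact hX.2.2.1
  refine ⟨hne, ?_⟩
  obtain ⟨q, hq, hqM⟩ := Nat.exists_prime_and_dvd hne
  have hq2 : q ^ 2 ∣ M₀ := sq_dvd_optimalLevel_of_prime_dvd hMD hpMD hDM₀ hmultD hq hqM
  have hle : q ^ 2 ≤ M₀ := Nat.le_of_dvd (Nat.pos_of_ne_zero hM₀) hq2
  have hq2' : 2 ≤ q := hq.two_le
  nlinarith

end OptimalLevel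

end Summit.BirchSwinnertonDyer.BirchSwinnertonDyer.Theorems.GL1Cartan

end
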